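import Literature.AlgebraicGeometry.Frobenioids.UnitsFunctorAutRigidity
import Literature.IUT.HodgeTheaters.GlobalFrobenioidsArithmeticModel
import HarnessLib

/-!
# [IUTchI] Example 5.1 (ii)/(v) at the arithmetic model: a natural endomorphism of the rational-function monoid
# `𝔹 = (A ↦ 𝕄^⊛(†𝒟^⊚)^A)` of `ℱ^⊛(†𝒟^⊚)` that relabels finite places on principal divisors is the IDENTITY

S. Mochizuki, *Inter-universal Teichmüller theory I*, kurims manuscript (May 2020), §5 Example 5.1 (ii) p. 125 (the
rational-function monoid `A ↦ 𝕄^⊛(†𝒟^⊚)^A` and `𝕄^⊛(†𝒟^⊚)^A → Φ^⊛(†𝒟^⊚)(A)^gp` of `ℱ^⊛(†𝒟^⊚)`) and (v) pp. 127–129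
(«by considering divisors of zeroes and poles … from the elementary observation that, relative to the natural inclusion
`ℚ ↪ Ẑ ⊗ ℚ`, `ℚ_{>0} ∩ Ẑ^× = {1}`»), consumer locus Corollary 5.3 (i) proof p. 144 l. 31–33
([IUTchI] Ex 5.1 (v) p.128) [claim: Mochizuki2012, status: disputed] (D-0012 claim key; nothing of the series is
asserted; no side taken on [IUTchIII] Cor. 3.12).  The mathematics is CLASSICAL (OURS): S. Mochizuki, *The geometry
of Frobenioids I*, Kyushu J. Math. **62** (2008), Example 6.3 p. 113 (the monoid `B : Spec L ↦ L^×` and `div`)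
[cite: MochizukiFrdI2008, Ex. 6.3 p.113], and abc-iut-L1's files `GaloisEquivariantUnitsEndomorphismRigidity.lean` /
`UnitsFunctorAutRigidity.lean` (the rigidity theorem over `FinSubextCat F F̄`).

PROOF-ONLY (cell abc-iut, seat abc-iut-L5-t16 gen 13, row «BRIGID-KUMMER» file 3, the `(arith F).B`-form; abc-iut-L5-lead
RULINGS #160 (1) / #161 (4); 0 def · 0 instance · 0 notation · no Prop fact).  At the arithmetic model
`GlobalDivisorData.arith F` (`GlobalFrobenioidsArithmeticModel.lean`: `𝔹 := (galoisSubextOfFinite F).op ⋙ unitsFunctor F F̄`,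
`𝔹(A) = (F̄^{Stab(a_A)})^×` by `rfl`) the functor-form rigidity transports VERBATIM along the Galois-correspondence
equivalence `galoisSubextOfFinite F : ℬ(G_F)⁰ ⥤ FinSubextCat F F̄` (whiskering along an equivalence is fully faithful):

* **`GlobalDivisorData.arith_B_natEnd_eq_id_of_ordFin_perm`** — a natural ENDOMORPHISM `α` of `(arith F).B` whose component
  at ONE object `A₀ ∈ Ob(†𝒟^⊛)` relabels the finite places of the number field of `A₀` on principal divisors
  (`ord_{θ w}(α u) = ord_w(u)`) is `𝟙`; `…_app_apply_eq_self` the elementwise reading; `…_perm_eq_refl`: `θ = 1`;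
* **`GlobalDivisorData.arith_B_natEnd_eq_id_of_divB_compat`** — the same from the RAW shape a self-equivalence of
  `ℱ^⊛(†𝒟^⊚)` delivers ([FrdI] Cor 4.11 (iv) + Thm 5.2 (i) relation (d)): a monoid automorphism `θ` of `Φ^⊛(A₀)` with
  `Div_B (α_{A₀} u) = θ^gp (Div_B u)` for all `u ∈ 𝔹(A₀)` (the tree's `divB`, `MonGp.map`);
* **`GlobalDivisorData.arith_B_unitsFamily_apply_eq_self_of_divB_compat`** — the OBJECTWISE-FAMILY currency of the (a)-half
  (abc-iut-L5-t11's sizing memo 227bec8bafab06cc § 3): a family `ᾱ_A : 𝔹(A) ≃* 𝔹(A)` natural in `A` along every arrow of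
  `†𝒟^⊛` (`ᾱ_{A'} (g^* w) = g^* (ᾱ_A w)`) with the `Div_B` law through some automorphism of `Φ^⊛(A₀)` at ONE `A₀` is the identity
  family: `ᾱ_A w = w` for all `A`, `w`.

This is the (b)-half «BRIGID-KUMMER» of the binder `hB` (𝔹-RATIO) of `Cor53.arith_rigidOverBase_of_ratioRigid`
(GAP-LEDGER G-L5t11g16-2 / D-G-L5t11g16-2) in the shape the (a)-half «C411-UNITS@ARITH» (abc-iut-L5-t11) produces.
HONEST TAGS: classical lemma about OUR model; typed ≠ proved for Cor 5.3 (i); nothing here asserts abc proved or refuted.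
-/

noncomputable section

namespace Literature.IUT.HodgeTheaters

open CategoryTheory Opposite NumberField Literature.AlgebraicGeometry.Frobenioids
open Literature.AlgebraicGeometry.Frobenioids.QuasiTemperoid

namespace GlobalDivisorData

variable (F : Type) [Field F] [NumberField F]

/-- **Rigidity of the rational-function monoid `𝔹` of `ℱ^⊛(†𝒟^⊚)` (arithmetic model)**: a natural endomorphism `α` of
`(arith F).B = (A ↦ (F̄^{Stab(a_A)})^×)` such that, at ONE object `A₀`, `ord_{θ w}(α_{A₀} u) = ord_w(u)` for a permutation
`θ` of the finite places of the number field of `A₀` and all `u`, `w`, is the identity — the functor-form theorem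
`unitsFunctor_natEnd_eq_id_of_ordFin_perm` transported along the equivalence `galoisSubextOfFinite F`
(`α = whiskerLeft _ α_U` with the SAME components). ([IUTchI] Ex 5.1 (v) p.128)
[cite: MochizukiFrdI2008, Ex. 6.3 p.113] [claim: Mochizuki2012, status: disputed] -/
theorem arith_B_natEnd_eq_id_of_ordFin_perm (α : (arith F).B ⟶ (arith F).B) (A₀ : BaseCat (absGalGrp F))
    (θ : Equiv.Perm (FinitePlace ((galoisSubextOfFinite F).obj A₀).L))
    (hval : ∀ (u : (((galoisSubextOfFinite F).obj A₀).L)ˣ) (w : FinitePlace ((galoisSubextOfFinite F).obj A₀).L),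
      ordFin _ (θ w) ((α.app (op A₀)).hom u) = ordFin _ w u) :
    α = 𝟙 (arith F).B := by
  haveI : IsGalois F (Fbar F) := isGalois_fbar F
  haveI := isEquivalence_galoisSubextOfFinite F
  -- whiskering along the equivalence `ℬ(G_F)⁰ ⥤ FinSubextCat F F̄` is fully faithful on functor categories
  let e : BaseCat (absGalGrp F) ≌ FinSubextCat F (Fbar F) := (galoisSubextOfFinite F).asEquivalence
  let ff := (e.op.congrLeft (E := CommMonCat.{0})).fullyFaithfulInverse
  let αU : unitsFunctor F (Fbar F) ⟶ unitsFunctor F (Fbar F) :=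
    ff.preimage (X := unitsFunctor F (Fbar F)) (Y := unitsFunctor F (Fbar F)) α
  have hmap : Functor.whiskerLeft (galoisSubextOfFinite F).op αU = α :=
    ff.map_preimage (X := unitsFunctor F (Fbar F)) (Y := unitsFunctor F (Fbar F)) α
  have happ : αU.app (op ((galoisSubextOfFinite F).obj A₀)) = α.app (op A₀) :=
    congrArg (fun β => NatTrans.app β (op A₀)) hmap
  -- the hypothesis at `A₀` is the hypothesis at `Spec K_{A₀}` for `α_U`
  have hval' : ∀ (u : (((galoisSubextOfFinite F).obj A₀).L)ˣ) (w : FinitePlace ((galoisSubextOfFinite F).obj A₀).L),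
      ordFin _ (θ w) ((αU.app (op ((galoisSubextOfFinite F).obj A₀))).hom u) = ordFin _ w u := by
    intro u w
    rw [happ]
    exact hval u w
  have hU := unitsFunctor_natEnd_eq_id_of_ordFin_perm αU ((galoisSubextOfFinite F).obj A₀) θ hval'
  rw [← hmap, hU, Functor.whiskerLeft_id']
  rfl

/-- Elementwise reading: under the same hypothesis every component of `α` is the identity map on
`𝔹(A) = (F̄^{Stab(a_A)})^×`. ([IUTchI] Ex 5.1 (v) p.128) [cite: MochizukiFrdI2008, Ex. 6.3 p.113]
[claim: Mochizuki2012, status: disputed] -/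
theorem arith_B_natEnd_app_apply_eq_self (α : (arith F).B ⟶ (arith F).B) (A₀ : BaseCat (absGalGrp F))
    (θ : Equiv.Perm (FinitePlace ((galoisSubextOfFinite F).obj A₀).L))
    (hval : ∀ (u : (((galoisSubextOfFinite F).obj A₀).L)ˣ) (w : FinitePlace ((galoisSubextOfFinite F).obj A₀).L),
      ordFin _ (θ w) ((α.app (op A₀)).hom u) = ordFin _ w u)
    (A : BaseCat (absGalGrp F)) (u : (((galoisSubextOfFinite F).obj A).L)ˣ) : (α.app (op A)).hom u = u := by
  rw [arith_B_natEnd_eq_id_of_ordFin_perm F α A₀ θ hval, NatTrans.id_app, CommMonCat.hom_id, MonoidHom.id_apply]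

/-- … and the relabelling `θ` itself is trivial. ([IUTchI] Ex 5.1 (v) p.128) [cite: MochizukiFrdI2008, Ex. 6.3 p.113]
[claim: Mochizuki2012, status: disputed] -/
theorem arith_B_natEnd_perm_eq_refl (α : (arith F).B ⟶ (arith F).B) (A₀ : BaseCat (absGalGrp F))
    (θ : Equiv.Perm (FinitePlace ((galoisSubextOfFinite F).obj A₀).L))
    (hval : ∀ (u : (((galoisSubextOfFinite F).obj A₀).L)ˣ) (w : FinitePlace ((galoisSubextOfFinite F).obj A₀).L),
      ordFin _ (θ w) ((α.app (op A₀)).hom u) = ordFin _ w u) :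
    θ = Equiv.refl _ := by
  haveI : IsGalois F (Fbar F) := isGalois_fbar F
  haveI := isEquivalence_galoisSubextOfFinite F
  let e : BaseCat (absGalGrp F) ≌ FinSubextCat F (Fbar F) := (galoisSubextOfFinite F).asEquivalence
  let ff := (e.op.congrLeft (E := CommMonCat.{0})).fullyFaithfulInverse
  let αU : unitsFunctor F (Fbar F) ⟶ unitsFunctor F (Fbar F) :=
    ff.preimage (X := unitsFunctor F (Fbar F)) (Y := unitsFunctor F (Fbar F)) α
  have hmap : Functor.whiskerLeft (galoisSubextOfFinite F).op αU = α :=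
    ff.map_preimage (X := unitsFunctor F (Fbar F)) (Y := unitsFunctor F (Fbar F)) α
  have happ : αU.app (op ((galoisSubextOfFinite F).obj A₀)) = α.app (op A₀) :=
    congrArg (fun β => NatTrans.app β (op A₀)) hmap
  have hval' : ∀ (u : (((galoisSubextOfFinite F).obj A₀).L)ˣ) (w : FinitePlace ((galoisSubextOfFinite F).obj A₀).L),
      ordFin _ (θ w) ((αU.app (op ((galoisSubextOfFinite F).obj A₀))).hom u) = ordFin _ w u := by
    intro u w
    rw [happ]
    exact hval u w
  exact perm_eq_refl_of_unitsFunctor_natEnd_ordFin_perm αU ((galoisSubextOfFinite F).obj A₀) θ hval'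

/-- **The RAW divisor-compatibility form at `ℱ^⊛(†𝒟^⊚)`**: a natural endomorphism `α` of `(arith F).B` such that, at
ONE object `A₀`, some monoid automorphism `θ` of `Φ^⊛(A₀)` satisfies `Div_B (α_{A₀} u) = θ^gp (Div_B u)` for every
`u ∈ 𝔹(A₀)` (the shape in which a self-equivalence of the model Frobenioid moves principal divisors, [FrdI] Cor 4.11
(iv) with Thm 5.2 (i) relation (d)), is the identity — abc-iut-L1's `unitsFunctor_natEnd_eq_id_of_divB_compat`
transported along `galoisSubextOfFinite F`. ([IUTchI] Ex 5.1 (v) p.128) [cite: MochizukiFrdI2008, Ex. 6.3 p.113]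
[claim: Mochizuki2012, status: disputed] -/
theorem arith_B_natEnd_eq_id_of_divB_compat (α : (arith F).B ⟶ (arith F).B) (A₀ : BaseCat (absGalGrp F))
    (θ : (arith F).Φ.obj (op A₀) ≃* (arith F).Φ.obj (op A₀))
    (hdiv : ∀ u : (arith F).B.obj (op A₀),
      divB (arith F).Φ (arith F).B (arith F).div (op A₀) ((α.app (op A₀)).hom u) =
        MonGp.map (MulEquiv.toMonoidHom (M := (arith F).Φ.obj (op A₀)) (N := (arith F).Φ.obj (op A₀)) θ)
          (divB (arith F).Φ (arith F).B (arith F).div (op A₀) u)) :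
    α = 𝟙 (arith F).B := by
  haveI : IsGalois F (Fbar F) := isGalois_fbar F
  haveI := isEquivalence_galoisSubextOfFinite F
  let e : BaseCat (absGalGrp F) ≌ FinSubextCat F (Fbar F) := (galoisSubextOfFinite F).asEquivalence
  let ff := (e.op.congrLeft (E := CommMonCat.{0})).fullyFaithfulInverse
  let αU : unitsFunctor F (Fbar F) ⟶ unitsFunctor F (Fbar F) :=
    ff.preimage (X := unitsFunctor F (Fbar F)) (Y := unitsFunctor F (Fbar F)) α
  have hmap : Functor.whiskerLeft (galoisSubextOfFinite F).op αU = α :=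
    ff.map_preimage (X := unitsFunctor F (Fbar F)) (Y := unitsFunctor F (Fbar F)) α
  have happ : αU.app (op ((galoisSubextOfFinite F).obj A₀)) = α.app (op A₀) :=
    congrArg (fun β => NatTrans.app β (op A₀)) hmap
  -- the hypothesis at `A₀` is the `Div_B`-hypothesis at `Spec K_{A₀}` for `α_U`
  have hdiv' : ∀ u : (((galoisSubextOfFinite F).obj A₀).L)ˣ,
      MonGp.map θ.toMonoidHom ((EffArithDivisor.gpEquiv _).symm (principalArithDivisorHom _ u)) =
        (EffArithDivisor.gpEquiv _).symm
          (principalArithDivisorHom _ ((αU.app (op ((galoisSubextOfFinite F).obj A₀))).hom u)) := by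
    intro u
    rw [happ]
    exact (hdiv u).symm
  have hU := unitsFunctor_natEnd_eq_id_of_divB_compat αU ((galoisSubextOfFinite F).obj A₀) θ hdiv'
  rw [← hmap, hU, Functor.whiskerLeft_id']
  rfl

/-- **The objectwise-family currency** (the shape of the (a)-half «C411-UNITS@ARITH»): a family of automorphisms
`ᾱ_A : 𝔹(A) ⥲ 𝔹(A)` (`A ∈ Ob(†𝒟^⊛)`), natural along every arrow `g : A' → A` of `†𝒟^⊛` (`ᾱ_{A'} (g^* w) = g^* (ᾱ_A w)` —
restrictions AND Galois conjugations), such that at ONE object `A₀` the divisor map is moved through some monoid automorphism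
`e` of `Φ^⊛(A₀)` (`Div_B (ᾱ_{A₀} w) = e^gp (Div_B w)`), is the IDENTITY family.  (Package the family as a natural endomorphism
of `(arith F).B` and apply `arith_B_natEnd_eq_id_of_divB_compat`.) ([IUTchI] Ex 5.1 (v) p.128)
[cite: MochizukiFrdI2008, Ex. 6.3 p.113] [claim: Mochizuki2012, status: disputed] -/
theorem arith_B_unitsFamily_apply_eq_self_of_divB_compat
    (ᾱ : ∀ A : BaseCat (absGalGrp F), (arith F).B.obj (op A) ≃* (arith F).B.obj (op A))
    (hnat : ∀ ⦃A' A : BaseCat (absGalGrp F)⦄ (g : A' ⟶ A) (w : (arith F).B.obj (op A)),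
      ᾱ A' (pull (arith F).B g w) = pull (arith F).B g (ᾱ A w))
    (A₀ : BaseCat (absGalGrp F)) (e : (arith F).Φ.obj (op A₀) ≃* (arith F).Φ.obj (op A₀))
    (hdiv : ∀ w : (arith F).B.obj (op A₀),
      divB (arith F).Φ (arith F).B (arith F).div (op A₀) (ᾱ A₀ w) =
        MonGp.map (MulEquiv.toMonoidHom (M := (arith F).Φ.obj (op A₀)) (N := (arith F).Φ.obj (op A₀)) e)
          (divB (arith F).Φ (arith F).B (arith F).div (op A₀) w))
    (A : BaseCat (absGalGrp F)) (w : (arith F).B.obj (op A)) : ᾱ A w = w := by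
  -- the family as a natural endomorphism of `(arith F).B`
  let α : (arith F).B ⟶ (arith F).B :=
    { app := fun X => CommMonCat.ofHom (ᾱ X.unop).toMonoidHom
      naturality := by
        intro X Y f
        apply CommMonCat.hom_ext
        refine MonoidHom.ext fun w => ?_
        exact hnat f.unop w }
  have happ : ∀ (X : BaseCat (absGalGrp F)) (w : (arith F).B.obj (op X)), (α.app (op X)).hom w = ᾱ X w := fun X w => rfl
  have hdiv' : ∀ u : (arith F).B.obj (op A₀),
      divB (arith F).Φ (arith F).B (arith F).div (op A₀) ((α.app (op A₀)).hom u) =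
        MonGp.map (MulEquiv.toMonoidHom (M := (arith F).Φ.obj (op A₀)) (N := (arith F).Φ.obj (op A₀)) e)
          (divB (arith F).Φ (arith F).B (arith F).div (op A₀) u) := fun u => by rw [happ]; exact hdiv u
  have hid := arith_B_natEnd_eq_id_of_divB_compat F α A₀ e hdiv'
  rw [← happ A w, hid, NatTrans.id_app, CommMonCat.hom_id, MonoidHom.id_apply]

end GlobalDivisorData

end Literature.IUT.HodgeTheaters

end
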